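import Summits.AtomisticToContinuum.FouriersLaw.Theses.OddSectorIrreversibility
import Summits.AtomisticToContinuum.FouriersLaw.Theses.FeketeSeriesLaw

/-!
# Stub `stub_selfSimilarGluing` (S23) — STATUS: open (crux-sized); reduction to the series-law crux
# `FeketeSeriesLaw.QuasiSubadditiveResistance`, proved

Crux `stmt-AtomisticToContinuum-9141` (`OddSectorIrreversibility.BoundedResponseConverges`), line
`two-scale-gluing-log-rigidity`, registered stub `stub_selfSimilarGluing` (S23, the hardest stub, held by the
lead): under the crux's prefix (parameters `> 0`, weak-NESS uniqueness, a steady family, `T > 0`, response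
coefficients `D`) and `0 < D N` for `N ≥ 2`,
`∃ ε antitone, Σ_k ε(2^k) < ∞, ∃ N₀, ∀ N ≥ N₀, R_{2N} ≤ 2R_N + N·ε N ∧ R_{3N} ≤ 3R_N + N·ε N`
with `R_N := (N-1)/D_N` the bath-to-bath linear-response resistance.

This file does NOT declare the stub: (S23) is an `N`-UNIFORM one-sided comparison between the NESS
responses of the chains of lengths `N`, `2N`, `3N`; no such comparison is proved in the tree or in print for
a deterministic anharmonic chain (BonettoLebowitzReyBellet2000 §6.3; no Dirichlet/Thomson principle for the
boundary-noise hypoelliptic chain, LandimMarianiSeo2018 being non-degenerate only). What it records,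
kernel-checked, is WHERE (S23) sits among the existing items:

* `selfSimilarGluing_of_quasiSubadditive` — (S23) follows from the single route item
  `FeketeSeriesLaw.QuasiSubadditiveResistance` (stmt-AtomisticToContinuum-14041: `∃ C ∀ N, M ≥ 2,
  R_{N+M} ≤ R_N + R_M + C`) with the explicit slack `ε N = 4·max(C,0)/(N+1)` (antitone, dyadically
  summable), `N₀ = 2`: `R_{2N} ≤ 2R_N + C`, `R_{3N} ≤ R_N + R_{2N} + C ≤ 3R_N + 2C`, and `2C ≤ N ε N` for
  `N ≥ 1`. So (S23) is WEAKER than the series-law crux (it restricts the splits to the two self-similar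
  ones and relaxes the `O(1)` defect to a Dini-summable `N ε(N)`); the positivity hypothesis of (S23) is not
  even used. The converse fails (`D_N = κ(1 + c/log N)`: (S23) holds with `ε(2^k) ≍ 1/k²`, QSR fails).
* `gluing_slack_antitone`, `gluing_slack_summable` — the slack bookkeeping, reusable for any `O(1)`-defect
  supplier.

Not recorded as theorems (assessed by the lead, see NOTES.md `## Census`): `ParabolicBathMap.BathOrbitParabolic`
(convergent increments) does NOT imply (S23) — a Cesàro rate is needed for the dyadic summability
(`r_n - r ≍ 1/log n` gives `ε(2^k) ≍ 1/k`); the ladder (`D_N ≤ D_{N+1}` eventually) implies (S23) at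
sequence level (`gluing_of_monotone` in the skeleton) but is not a tree item.
-/

noncomputable section

namespace Summit.AtomisticToContinuum.FouriersLaw.Cruxes.BoundedResponseConverges.TwoScaleGluingLogRigidity.Stubs

open Filter Topology
open Literature.MathematicalPhysics.KineticTheory.HeatConduction

/-! ## The slack `4·C⁺/(N+1)` -/

/-- The slack `N ↦ 4c/(N+1)` is antitone for `c ≥ 0`. [folklore] -/
theorem gluing_slack_antitone {c : ℝ} (hc : 0 ≤ c) : Antitone (fun N : ℕ => 4 * c / ((N : ℝ) + 1)) := by
  intro a b hab
  dsimp only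
  have hab' : (a : ℝ) + 1 ≤ (b : ℝ) + 1 := by exact_mod_cast Nat.succ_le_succ hab
  exact div_le_div_of_nonneg_left (by positivity) (by positivity) hab'

/-- The slack `N ↦ 4c/(N+1)` is summable along the powers of two (for any `c`). [folklore] -/
theorem gluing_slack_summable (c : ℝ) : Summable (fun k : ℕ => 4 * c / ((((2 : ℕ) ^ k : ℕ) : ℝ) + 1)) := by
  have hgeom : Summable (fun k : ℕ => (4 * c) * (1 / 2 : ℝ) ^ k) :=
    (summable_geometric_of_lt_one (by norm_num) (by norm_num)).mul_left _
  have habs : Summable (fun k : ℕ => |4 * c| * (1 / 2 : ℝ) ^ k) :=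
    (summable_geometric_of_lt_one (by norm_num) (by norm_num)).mul_left _
  refine Summable.of_norm_bounded habs (fun k => ?_)
  have hcast : ((((2 : ℕ) ^ k : ℕ) : ℝ)) = (2 : ℝ) ^ k := by push_cast; ring
  have h2pow : (0 : ℝ) < (2 : ℝ) ^ k := by positivity
  rw [Real.norm_eq_abs, hcast, abs_div, abs_of_pos (by positivity : (0 : ℝ) < 2 ^ k + 1)]
  rw [div_le_iff₀ (by positivity)]
  have hk : (1 / 2 : ℝ) ^ k * (2 : ℝ) ^ k = 1 := by
    rw [← mul_pow]; norm_num
  have habs0 : 0 ≤ |4 * c| * (1 / 2 : ℝ) ^ k := by positivity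
  calc |4 * c| ≤ |4 * c| + |4 * c| * (1 / 2 : ℝ) ^ k := le_add_of_nonneg_right habs0
    _ = |4 * c| * ((1 / 2 : ℝ) ^ k * (2 : ℝ) ^ k) + |4 * c| * (1 / 2 : ℝ) ^ k := by rw [hk, mul_one]
    _ = |4 * c| * (1 / 2 : ℝ) ^ k * ((2 : ℝ) ^ k + 1) := by ring

/-! ## (S23) from quasi-subadditivity of the resistance -/

/-- **(S23) from the series-law crux.** `FeketeSeriesLaw.QuasiSubadditiveResistance`
(stmt-AtomisticToContinuum-14041: `R_{N+M} ≤ R_N + R_M + C` for all `N, M ≥ 2`) implies the registered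
stub `stub_selfSimilarGluing` verbatim, with `ε N = 4·max(C,0)/(N+1)` and `N₀ = 2`. [folklore] -/
theorem selfSimilarGluing_of_quasiSubadditive :
    Summit.AtomisticToContinuum.FouriersLaw.Theses.FeketeSeriesLaw.QuasiSubadditiveResistance →
    ∀ ω₂ lam β γ : ℝ, 0 < ω₂ → 0 < lam → 0 < β → 0 < γ →
    (∀ (N : ℕ) (T_L T_R : ℝ), 0 < T_L → 0 < T_R →
      ∀ μ ν : MeasureTheory.Measure (Literature.MathematicalPhysics.KineticTheory.HeatConduction.PhaseSpace N),
        (Literature.MathematicalPhysics.KineticTheory.HeatConduction.pinnedChain ω₂ lam β γ).IsSteadyState N T_L T_R μ →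
        (Literature.MathematicalPhysics.KineticTheory.HeatConduction.pinnedChain ω₂ lam β γ).IsSteadyState N T_L T_R ν →
        μ = ν) →
    ∀ μ : (N : ℕ) → ℝ → ℝ →
        MeasureTheory.Measure (Literature.MathematicalPhysics.KineticTheory.HeatConduction.PhaseSpace N),
    (∀ (N : ℕ) (T_L T_R : ℝ), 0 < T_L → 0 < T_R →
      (Literature.MathematicalPhysics.KineticTheory.HeatConduction.pinnedChain ω₂ lam β γ).IsSteadyState N T_L T_R
        (μ N T_L T_R)) →
    ∀ T : ℝ, 0 < T → ∀ D : ℕ → ℝ,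
    (∀ N : ℕ, Filter.Tendsto (fun δ : ℝ =>
        (Literature.MathematicalPhysics.KineticTheory.HeatConduction.pinnedChain ω₂ lam β γ).totalCurrent
          (μ N (T + δ / 2) (T - δ / 2)) / δ) (nhdsWithin 0 {(0 : ℝ)}ᶜ) (nhds (D N))) →
    (∀ N : ℕ, 2 ≤ N → 0 < D N) →
    ∃ ε : ℕ → ℝ, Antitone ε ∧ Summable (fun k : ℕ => ε (2 ^ k)) ∧
      ∃ N₀ : ℕ, ∀ N : ℕ, N₀ ≤ N →
        (((2 * N : ℕ) : ℝ) - 1) / D (2 * N) ≤ 2 * (((N : ℝ) - 1) / D N) + (N : ℝ) * ε N ∧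
        (((3 * N : ℕ) : ℝ) - 1) / D (3 * N) ≤ 3 * (((N : ℝ) - 1) / D N) + (N : ℝ) * ε N := by
  intro hQ ω₂ lam β γ hω hl hβ hγ hUniq μ hμ T hT D hD _hpos
  obtain ⟨C, hC⟩ := hQ ω₂ lam β γ hω hl hβ hγ hUniq μ hμ T hT D hD
  set c : ℝ := max C 0 with hc
  have hc0 : 0 ≤ c := le_max_right _ _
  have hCc : C ≤ c := le_max_left _ _
  refine ⟨fun N => 4 * c / ((N : ℝ) + 1), gluing_slack_antitone hc0, ?_, 2, fun N hN => ?_⟩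
  · have := gluing_slack_summable c
    simpa using this
  -- casts
  have hN1 : 1 ≤ N := le_trans (by norm_num) hN
  have castN : (((N - 1 : ℕ) : ℝ)) = (N : ℝ) - 1 := by
    rw [Nat.cast_sub hN1]; simp
  have cast2 : (((N + N - 1 : ℕ) : ℝ)) = ((2 * N : ℕ) : ℝ) - 1 := by
    rw [Nat.cast_sub (by omega)]; push_cast; ring
  have cast3 : (((N + 2 * N - 1 : ℕ) : ℝ)) = ((3 * N : ℕ) : ℝ) - 1 := by
    rw [Nat.cast_sub (by omega)]; push_cast; ring
  have cast2' : (((2 * N - 1 : ℕ) : ℝ)) = ((2 * N : ℕ) : ℝ) - 1 := by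
    rw [Nat.cast_sub (by omega)]; push_cast; ring
  -- QSR at (N, N) and (N, 2N)
  have h2N : 2 ≤ 2 * N := by omega
  have hA := hC N N hN hN
  have hB := hC N (2 * N) hN h2N
  rw [cast2, castN, show N + N = 2 * N by ring] at hA
  rw [cast3, castN, cast2', show N + 2 * N = 3 * N by ring] at hB
  -- the slack dominates `2C`
  have hNr : (1 : ℝ) ≤ N := by exact_mod_cast hN1
  have hslack : 2 * C ≤ (N : ℝ) * (4 * c / ((N : ℝ) + 1)) := by
    have hpos : (0 : ℝ) < (N : ℝ) + 1 := by positivity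
    rw [mul_div_assoc', le_div_iff₀ hpos]
    nlinarith [hCc, hc0, hNr]
  have hslack1 : C ≤ (N : ℝ) * (4 * c / ((N : ℝ) + 1)) := by
    have : C ≤ 2 * C ∨ C ≤ 0 := by
      rcases le_or_gt 0 C with h | h
      · left; linarith
      · right; exact h.le
    rcases this with h | h
    · exact h.trans hslack
    · have : 0 ≤ (N : ℝ) * (4 * c / ((N : ℝ) + 1)) := by positivity
      linarith
  constructor
  · -- doubling
    linarith [hA, hslack1]
  · -- tripling: R_{3N} ≤ R_N + R_{2N} + C ≤ 3 R_N + 2C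
    linarith [hA, hB, hslack]

end Summit.AtomisticToContinuum.FouriersLaw.Cruxes.BoundedResponseConverges.TwoScaleGluingLogRigidity.Stubs

end
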